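/-
Copyright (c) 2026. All rights reserved.
Released under Apache 2.0 license as described in the file LICENSE.
Authors: abc-iut cell — seat abc-iut-w4-d104 (gen 3): row «COR28-CHART-INDEP» — [AbsTopIII] Cor 2.8 (b), the
chart independence of `𝒜_X(U_X)` under bi-analytic transitions (SUBDAG-Cor-28 row b.r11, statement of
abc-iut-w5-d140 consumed by name).
-/
import Literature.AnabelianGeometry.AbsoluteAnabelian.ArchimedeanReconstructionCor28Sub
import Literature.AnabelianGeometry.AbsoluteAnabelian.AutHolomorphicSpacesProofs
import HarnessLib

/-!
# [AbsTopIII] Cor 2.8 (b): `𝒜_X(U_X) := f_U⁻¹ ∘ Aut^hol(U_v) ∘ f_U` does not depend on the chart when the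
# transitions are bi-analytic

S. Mochizuki, *Topics in absolute anabelian geometry III* (bib key `MochizukiAbsTopIII2015`), Cor 2.8 (b),
kurims pp.63–64 (paraphrase): for charts `f_U : U_X ⥲ U_v ⊆ k_v` of `X^top` defined by NF-rational
functions, `𝒜_X(U_X)` is `Aut^hol(U_v)` ("self-homeomorphisms which can locally be expressed as a convergent
power series with coefficients in `k_v`") transported along `f_U`; the reconstructed Aut-holomorphic structure
is the one extending these groups.  The sub-DAG of abc-iut-w5-d140 (plan/L4/SUBDAG-AbsTopIII-Cor-28.md,
row b.r11) typed the implicit well-definedness as `NFCurveData.ChartAutIndependent` (p414194) and proved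
`ReconstructsAutHolOnCharts` from it.  As a statement about the ABSTRACT datum it is not provable (two
interface charts of the same open need not differ by an analytic map — the schema phenomenon of F-0063 /
F-2445); print's reason is that for NF-rational `f`, `f′` the transition `f′_U ∘ f_U⁻¹` is bi-analytic.  This
PROOF-ONLY file (no definitions) proves the row in that dischargeable form:

* `analyticAt_extendHomeo_conj`, `homeoConj_mem_autHolv`, `autHolv_map_homeoConj` — conjugation by a
  homeomorphism `T : U_v ⥲ U′_v` that is, together with its inverse, locally given by `k_v`-analytic
  functions carries `Aut^hol(U_v)` ONTO `Aut^hol(U′_v)`;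
* `NFCurveData.Chart.aut_eq_of_bianalytic_transition` — two charts of the same `U_X` with bi-analytic
  transition define the same `𝒜_X(U_X)`;
* `NFCurveData.chartAutIndependent_of_bianalytic_transitions` — (all transitions bi-analytic) →
  `D.ChartAutIndependent`; `NFCurveData.reconstructsAutHolOnCharts_of_bianalytic_transitions` — hence Cor 2.8
  (b) read on the charted opens (w5-d140's junction `reconstructsAutHolOnCharts_of_chartAutIndependent`).

HONEST SCOPE: the transition hypothesis is NAMED, not discharged (it is the analytic structure of `X_v(k_v)`,
owed by L4-t1's Thm 1.9 output); refereed pre-IUT material; nothing here bears on the disputed [IUTchIII]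
Cor. 3.12; typed ≠ endorsed.
-/

noncomputable section

namespace Literature.AnabelianGeometry.AbsoluteAnabelian

namespace ArchimedeanReconstruction

open _root_.Filter _root_.Topology _root_.Set _root_.TopologicalSpace

variable {D : NFCurveData}

/-! ### `extendHomeo` bookkeeping -/

/-- On `U`, the extension by the identity of `φ : U ≃ₜ U` is `φ`. (Auxiliary.)
[cite: MochizukiAbsTopIII2015, Corollary 2.8 (b) p.63] -/
theorem extendHomeo_apply_mem {k : Type} [TopologicalSpace k] (U : Opens k) (φ : U ≃ₜ U) {w : k}
    (hw : w ∈ U) : U.extendHomeo φ w = ((φ ⟨w, hw⟩ : U) : k) := by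
  simp [Opens.extendHomeo, hw]

/-! ### Conjugating `Aut^hol(U_v)` by a bi-analytic homeomorphism `T : U_v ⥲ U′_v` -/

/-- **Conjugation by a locally analytic homeomorphism preserves analyticity**: if `σ : U_v ⥲ U_v` is
analytic (extended by the identity) at every point of `U_v`, and `T : U_v ⥲ U′_v`, `T⁻¹` are locally given by
`k_v`-analytic functions, then `T ∘ σ ∘ T⁻¹ : U′_v ⥲ U′_v` is analytic at every point of `U′_v`.
[cite: MochizukiAbsTopIII2015, Corollary 2.8 (b) pp.63–64] -/
theorem analyticAt_extendHomeo_conj {Uv Uv' : Opens D.kv} (T : Uv ≃ₜ Uv')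
    (hT : ∀ z : Uv, ∃ F : D.kv → D.kv, AnalyticAt D.kv F (z : D.kv) ∧
      ∀ᶠ w in 𝓝 (z : D.kv), ∀ hw : w ∈ Uv, F w = ((T ⟨w, hw⟩ : Uv') : D.kv))
    (hT' : ∀ z' : Uv', ∃ F' : D.kv → D.kv, AnalyticAt D.kv F' (z' : D.kv) ∧
      ∀ᶠ w in 𝓝 (z' : D.kv), ∀ hw : w ∈ Uv', F' w = ((T.symm ⟨w, hw⟩ : Uv) : D.kv))
    {σ : Uv ≃ₜ Uv} (hσ : ∀ z : Uv, AnalyticAt D.kv (Uv.extendHomeo σ) z) (z' : Uv') :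
    AnalyticAt D.kv (Uv'.extendHomeo (T.symm.trans (σ.trans T))) z' := by
  -- `F'` represents `T⁻¹` near `z'`, `F` represents `T` near `σ (T⁻¹ z')`
  obtain ⟨F', hF'a, hF'e⟩ := hT' z'
  obtain ⟨F, hFa, hFe⟩ := hT (σ (T.symm z'))
  set G : D.kv → D.kv := fun w => Uv.extendHomeo σ (F' w) with hG
  -- `G` is analytic at `z'` and `G z' = σ (T⁻¹ z')`
  have hF'z : F' z' = ((T.symm z' : Uv) : D.kv) := by
    have h := hF'e.self_of_nhds z'.2
    rw [h]
  have hGz : G z' = ((σ (T.symm z') : Uv) : D.kv) := by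
    simp only [hG, hF'z, extendHomeo_apply_mem Uv σ (T.symm z').2, Subtype.coe_eta]
  have hGa : AnalyticAt D.kv G z' := by
    exact (hσ (T.symm z')).comp_of_eq hF'a hF'z
  have hcomp : AnalyticAt D.kv (fun w => F (G w)) z' := hFa.comp_of_eq hGa hGz
  refine hcomp.congr ?_
  -- eventual agreement near `z'`
  have hGcont : ContinuousAt G z' := hGa.continuousAt
  have hpull : ∀ᶠ w in 𝓝 (z' : D.kv), ∀ hu : G w ∈ Uv, F (G w) = ((T ⟨G w, hu⟩ : Uv') : D.kv) := by
    have h := hGcont.eventually (by rw [hGz]; exact hFe)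
    exact h
  filter_upwards [hpull, hF'e, Uv'.isOpen.mem_nhds z'.2] with w hw hw' hwU
  have hF'w : F' w = ((T.symm ⟨w, hwU⟩ : Uv) : D.kv) := hw' hwU
  have hGw : G w = ((σ (T.symm ⟨w, hwU⟩) : Uv) : D.kv) := by
    simp only [hG, hF'w, extendHomeo_apply_mem Uv σ (T.symm ⟨w, hwU⟩).2, Subtype.coe_eta]
  have hGmem : G w ∈ Uv := by rw [hGw]; exact (σ (T.symm ⟨w, hwU⟩)).2
  rw [hw hGmem, extendHomeo_apply_mem Uv' _ hwU]
  congr 1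
  have : (⟨G w, hGmem⟩ : Uv) = σ (T.symm ⟨w, hwU⟩) := Subtype.ext hGw
  rw [this]
  rfl

/-- **`T ∘ Aut^hol(U_v) ∘ T⁻¹ ⊆ Aut^hol(U′_v)`** for a bi-analytic `T`. [cite: MochizukiAbsTopIII2015, Corollary 2.8 (b) p.64] -/
theorem homeoConj_mem_autHolv {Uv Uv' : Opens D.kv} (T : Uv ≃ₜ Uv')
    (hT : ∀ z : Uv, ∃ F : D.kv → D.kv, AnalyticAt D.kv F (z : D.kv) ∧
      ∀ᶠ w in 𝓝 (z : D.kv), ∀ hw : w ∈ Uv, F w = ((T ⟨w, hw⟩ : Uv') : D.kv))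
    (hT' : ∀ z' : Uv', ∃ F' : D.kv → D.kv, AnalyticAt D.kv F' (z' : D.kv) ∧
      ∀ᶠ w in 𝓝 (z' : D.kv), ∀ hw : w ∈ Uv', F' w = ((T.symm ⟨w, hw⟩ : Uv) : D.kv))
    {ψ : Uv ≃ₜ Uv} (hψ : ψ ∈ D.autHolv Uv) : homeoConj T ψ ∈ D.autHolv Uv' := by
  obtain ⟨h1, h2⟩ := hψ
  refine ⟨fun z' => ?_, fun z' => ?_⟩
  · exact analyticAt_extendHomeo_conj T hT hT' h1 z'
  · have heq : (homeoConj T ψ).symm = T.symm.trans (ψ.symm.trans T) := by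
      ext w; rfl
    rw [heq]
    exact analyticAt_extendHomeo_conj T hT hT' h2 z'

/-- **`T ∘ Aut^hol(U_v) ∘ T⁻¹ = Aut^hol(U′_v)`** for a bi-analytic `T : U_v ⥲ U′_v`.
[cite: MochizukiAbsTopIII2015, Corollary 2.8 (b) p.64] -/
theorem autHolv_map_homeoConj {Uv Uv' : Opens D.kv} (T : Uv ≃ₜ Uv')
    (hT : ∀ z : Uv, ∃ F : D.kv → D.kv, AnalyticAt D.kv F (z : D.kv) ∧
      ∀ᶠ w in 𝓝 (z : D.kv), ∀ hw : w ∈ Uv, F w = ((T ⟨w, hw⟩ : Uv') : D.kv))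
    (hT' : ∀ z' : Uv', ∃ F' : D.kv → D.kv, AnalyticAt D.kv F' (z' : D.kv) ∧
      ∀ᶠ w in 𝓝 (z' : D.kv), ∀ hw : w ∈ Uv', F' w = ((T.symm ⟨w, hw⟩ : Uv) : D.kv)) :
    (D.autHolv Uv).map (homeoConj T).toMonoidHom = D.autHolv Uv' := by
  apply le_antisymm
  · rintro _ ⟨ψ, hψ, rfl⟩
    exact homeoConj_mem_autHolv T hT hT' hψ
  · intro ψ' hψ'
    refine ⟨homeoConj T.symm ψ', ?_, ?_⟩
    · have hT'' : ∀ z : Uv, ∃ F : D.kv → D.kv, AnalyticAt D.kv F (z : D.kv) ∧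
          ∀ᶠ w in 𝓝 (z : D.kv), ∀ hw : w ∈ Uv, F w = ((T.symm.symm ⟨w, hw⟩ : Uv') : D.kv) := by
        simpa only [Homeomorph.symm_symm] using hT
      exact homeoConj_mem_autHolv T.symm hT' hT'' hψ'
    · show homeoConj T (homeoConj T.symm ψ') = ψ'
      ext w
      simp [homeoConj]

/-! ### Chart independence of `𝒜_X(U_X)` -/

/-- **Cor 2.8 (b), row Cor-28.b.r11 in dischargeable form**: two charts `f_U : U_X ⥲ U_v`, `f′_U : U_X ⥲ U′_v`
of the same open `U_X` whose TRANSITION `f′_U ∘ f_U⁻¹ : U_v ⥲ U′_v` and its inverse are locally given by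
`k_v`-analytic functions define the same group `𝒜_X(U_X) = f_U⁻¹ ∘ Aut^hol(U_v) ∘ f_U` (print p.64: for
NF-rational `f`, `f′` the transition is bi-analytic, which is why `𝒜_X(U_X)` is well defined).
[cite: MochizukiAbsTopIII2015, Corollary 2.8 (b) p.64] -/
theorem NFCurveData.Chart.aut_eq_of_bianalytic_transition {UX : Opens D.Xtop} (c c' : D.Chart UX)
    (hT : ∀ z : c.Uv, ∃ F : D.kv → D.kv, AnalyticAt D.kv F (z : D.kv) ∧
      ∀ᶠ w in 𝓝 (z : D.kv), ∀ hw : w ∈ c.Uv, F w = ((c'.fU (c.fU.symm ⟨w, hw⟩) : c'.Uv) : D.kv))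
    (hT' : ∀ z' : c'.Uv, ∃ F' : D.kv → D.kv, AnalyticAt D.kv F' (z' : D.kv) ∧
      ∀ᶠ w in 𝓝 (z' : D.kv), ∀ hw : w ∈ c'.Uv, F' w = ((c.fU (c'.fU.symm ⟨w, hw⟩) : c.Uv) : D.kv)) :
    c.aut = c'.aut := by
  set T : c.Uv ≃ₜ c'.Uv := c.fU.symm.trans c'.fU with hTdef
  have hfU : c.fU.symm = T.trans c'.fU.symm := by
    ext w
    simp [hTdef]
  have hmap : (D.autHolv c.Uv).map (homeoConj T).toMonoidHom = D.autHolv c'.Uv :=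
    autHolv_map_homeoConj T (by simpa [hTdef] using hT) (by simpa [hTdef] using hT')
  unfold NFCurveData.Chart.aut
  rw [hfU, homeoConj_trans, ← Subgroup.map_map, hmap]

/-- **Row Cor-28.b.r11 under the transition hypothesis**: if all transitions between charts of the same open
are bi-analytic (true for the genuine `X_v`: NF-rational functions are analytic functions of one another
locally), then `D.ChartAutIndependent`; hence (w5-d140's junction) `D.ReconstructsAutHolOnCharts`.
[cite: MochizukiAbsTopIII2015, Corollary 2.8 (b) p.64] -/
theorem NFCurveData.chartAutIndependent_of_bianalytic_transitions
    (h : ∀ (UX : Opens D.Xtop) (c c' : D.Chart UX), ∀ z : c.Uv, ∃ F : D.kv → D.kv,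
      AnalyticAt D.kv F (z : D.kv) ∧
        ∀ᶠ w in 𝓝 (z : D.kv), ∀ hw : w ∈ c.Uv, F w = ((c'.fU (c.fU.symm ⟨w, hw⟩) : c'.Uv) : D.kv)) :
    D.ChartAutIndependent := fun UX c c' _ _ =>
  NFCurveData.Chart.aut_eq_of_bianalytic_transition c c' (h UX c c') (h UX c' c)

/-- **Cor 2.8 (b) read on the charted opens, under the transition hypothesis.**
[cite: MochizukiAbsTopIII2015, Corollary 2.8 (b) p.64] -/
theorem NFCurveData.reconstructsAutHolOnCharts_of_bianalytic_transitions
    (h : ∀ (UX : Opens D.Xtop) (c c' : D.Chart UX), ∀ z : c.Uv, ∃ F : D.kv → D.kv,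
      AnalyticAt D.kv F (z : D.kv) ∧
        ∀ᶠ w in 𝓝 (z : D.kv), ∀ hw : w ∈ c.Uv, F w = ((c'.fU (c.fU.symm ⟨w, hw⟩) : c'.Uv) : D.kv)) :
    D.ReconstructsAutHolOnCharts :=
  NFCurveData.reconstructsAutHolOnCharts_of_chartAutIndependent
    (NFCurveData.chartAutIndependent_of_bianalytic_transitions h)

end ArchimedeanReconstruction

end Literature.AnabelianGeometry.AbsoluteAnabelian

end
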